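import Summits.KontsevichZagierPeriods.Zeta5Search.LaiSweepShard

/-!
# `κ₃` sweep certificate — shard file 048 of 127 (shards 336–342 of 889)

HONEST FRAMING. Systematic search; no irrationality claim unless certified. This file only checks,
by `decide +kernel`, shards 336–342 of the order-cell sweep of the `κ₃` point `(74, 2180, 444; δ74)`
(engine `LaiSweepEngine`, soundness `LaiSweepJump/Free/Eval/Shard/Kappa3`; a shard is `⟨regime, n,
p, q, p', q', Lo, Up⟩`: `n` cells from `p/q` to `p'/q'` with integer rate sums in `[Lo, Up]`, `K =
128`, `D = 2^40`). It draws NO conclusion: only the capstone `LaiKappa3SweepCert`, which needs all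
127 shard files, does. Kernel cost of this file ≈ 560 cells × 0.3 s.
-/

namespace Summit.KontsevichZagierPeriods.Zeta5Search.Sweep

set_option maxHeartbeats 100000000 in
/-- Shard 336: 80 cells of regime B from `85/279` to `67/219`.
[cite: Lai2024BallRivoal, §4 Lemma 4.3] -/
theorem shard336 :
    Shard.check 128 (2^40)
      ⟨true, 80, 85, 279, 67, 219, 22645103156792, 24328211873714⟩ = true := by
  decide +kernel

set_option maxHeartbeats 100000000 in
/-- Shard 337: 80 cells of regime B from `67/219` to `90/293`.
[cite: Lai2024BallRivoal, §4 Lemma 4.3] -/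
theorem shard337 :
    Shard.check 128 (2^40)
      ⟨true, 80, 67, 219, 90, 293, 21774134352875, 23407418868717⟩ = true := by
  decide +kernel

set_option maxHeartbeats 100000000 in
/-- Shard 338: 80 cells of regime B from `90/293` to `91/295`.
[cite: Lai2024BallRivoal, §4 Lemma 4.3] -/
theorem shard338 :
    Shard.check 128 (2^40)
      ⟨true, 80, 90, 293, 91, 295, 23006450457778, 24750300525351⟩ = true := by
  decide +kernel

set_option maxHeartbeats 100000000 in
/-- Shard 339: 80 cells of regime B from `91/295` to `131/423`.
[cite: Lai2024BallRivoal, §4 Lemma 4.3] -/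
theorem shard339 :
    Shard.check 128 (2^40)
      ⟨true, 80, 91, 295, 131, 423, 21396848601927, 23031808509057⟩ = true := by
  decide +kernel

set_option maxHeartbeats 100000000 in
/-- Shard 340: 80 cells of regime B from `131/423` to `125/402`.
[cite: Lai2024BallRivoal, §4 Lemma 4.3] -/
theorem shard340 :
    Shard.check 128 (2^40)
      ⟨true, 80, 131, 423, 125, 402, 21907820404484, 23597054432181⟩ = true := by
  decide +kernel

set_option maxHeartbeats 100000000 in
/-- Shard 341: 80 cells of regime B from `125/402` to `123/394`.
[cite: Lai2024BallRivoal, §4 Lemma 4.3] -/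
theorem shard341 :
    Shard.check 128 (2^40)
      ⟨true, 80, 125, 402, 123, 394, 21583601201761, 23262732484028⟩ = true := by
  decide +kernel

set_option maxHeartbeats 100000000 in
/-- Shard 342: 80 cells of regime B from `123/394` to `121/386`.
[cite: Lai2024BallRivoal, §4 Lemma 4.3] -/
theorem shard342 :
    Shard.check 128 (2^40)
      ⟨true, 80, 123, 394, 121, 386, 22354566093540, 24110593588313⟩ = true := by
  decide +kernel

/-- The checked shards of this file, in order. [folklore] -/
def shards048 : List (CheckedShard 128 (2^40)) :=
  [⟨_, shard336⟩, ⟨_, shard337⟩, ⟨_, shard338⟩, ⟨_, shard339⟩, ⟨_, shard340⟩,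
    ⟨_, shard341⟩, ⟨_, shard342⟩]

end Summit.KontsevichZagierPeriods.Zeta5Search.Sweep
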